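import Summits.AnomalousDissipation.AnomalousDissipation.Theorems.SolenoidalFractalHomogenisationLagrangianStepLabelSplit
import HarnessLib

/-!
# K1L_D (stmt-AnomalousDissipation-27980), stub `stub_windowFactsH`: the (Z) FLOORS from the dissipation bound of W3-E (i) — `floor_of_dissipBound`
# (helper; `--supports … --as helper`; lead-k1l-onelevel-p1 g3)

`z_of_pieces` (…ZAssembly, p669953) wants the floors `c·(Σ_S d_k ‖𝓕u(k)‖² + (‖u‖² − Σ_S ‖𝓕u‖²)) ≤ 𝔇(u) = ‖u‖² − ‖T u‖²` (and the same for
`y` with `T†`).  W3-E §4c (i) (v27, propagator form) delivers `‖T u‖² ≤ ‖u‖² − ½ Σ' k, min(1, rate_k τ) ‖𝓕u(k)‖²`.  THIS FILE: if the weights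
`w_k := min(1, rate_k τ) ∈ [0,1]` equal `1` off the finite slow-low set `S` (every non-`S` mode is fully dissipated in one window:
`rate(Lcap/2)·refresh ≫ 1`), then the W3-E bound gives the floor with `c = ½` and `d_k := w_k` on `S`.  Pure `tsum` bookkeeping on `V2`.
NOT a proof of the stub, of the crux, or of AD; rung F-D1.A0.
-/

set_option linter.dupNamespace false

noncomputable section

namespace Summit.AnomalousDissipation.AnomalousDissipation.Theorems.SolenoidalFractalHomogenisation.LagrangianStep

open Literature.Analysis Literature.Analysis.FunctionSpaces
open MeasureTheory Set Filter UnitAddTorus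
open scoped ENNReal NNReal InnerProductSpace Classical
open OneLevelSplit

/-- Splitting the weighted Parseval series at a finite set: with weights `w ∈ [0,1]`, `= 1` off `S`,
`Σ' k, w_k ‖𝓕u(k)‖² = Σ_S w_k ‖𝓕u(k)‖² + (‖u‖² − Σ_S ‖𝓕u(k)‖²)`. -/
theorem tsum_weight_eq_sum_add_rest (S : Finset (Fin 3 → ℤ)) (u : V2) (w : (Fin 3 → ℤ) → ℝ)
    (hw1 : ∀ k, k ∉ S → w k = 1) :
    ∑' k, w k * ‖mFourierCoeff (EuclideanSpace.complexify ∘ ⇑u) k‖ ^ 2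
      = ∑ k ∈ S, w k * ‖mFourierCoeff (EuclideanSpace.complexify ∘ ⇑u) k‖ ^ 2
        + (‖u‖ ^ 2 - ∑ k ∈ S, ‖mFourierCoeff (EuclideanSpace.complexify ∘ ⇑u) k‖ ^ 2) := by
  have hP := hasSum_norm_sq_fcoeff u
  -- the difference `w_k a_k − a_k` is supported on `S`
  have hdiff : HasSum (fun k => w k * ‖mFourierCoeff (EuclideanSpace.complexify ∘ ⇑u) k‖ ^ 2
      - ‖mFourierCoeff (EuclideanSpace.complexify ∘ ⇑u) k‖ ^ 2)
      (∑ k ∈ S, (w k * ‖mFourierCoeff (EuclideanSpace.complexify ∘ ⇑u) k‖ ^ 2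
        - ‖mFourierCoeff (EuclideanSpace.complexify ∘ ⇑u) k‖ ^ 2)) :=
    hasSum_sum_of_ne_finset_zero fun k hk => by rw [hw1 k hk]; ring
  have hsum := hdiff.add hP
  have e : (fun k => w k * ‖mFourierCoeff (EuclideanSpace.complexify ∘ ⇑u) k‖ ^ 2
      - ‖mFourierCoeff (EuclideanSpace.complexify ∘ ⇑u) k‖ ^ 2 + ‖mFourierCoeff (EuclideanSpace.complexify ∘ ⇑u) k‖ ^ 2)
      = fun k => w k * ‖mFourierCoeff (EuclideanSpace.complexify ∘ ⇑u) k‖ ^ 2 := by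
    funext k; ring
  rw [e] at hsum
  rw [hsum.tsum_eq, Finset.sum_sub_distrib]
  ring

/-- **The (Z) floor from a W3-E (i)-type dissipation bound.**  If `‖T u‖² ≤ ‖u‖² − ½ Σ' w_k ‖𝓕u(k)‖²` with `w_k = 1` off `S`, then
`½ (Σ_S w_k ‖𝓕u(k)‖² + (‖u‖² − Σ_S ‖𝓕u‖²)) ≤ ‖u‖² − ‖T u‖²`. -/
theorem floor_of_dissipBound (S : Finset (Fin 3 → ℤ)) (T : V2 →L[ℝ] V2) (u : V2) (w : (Fin 3 → ℤ) → ℝ)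
    (hw1 : ∀ k, k ∉ S → w k = 1)
    (hT : ‖T u‖ ^ 2 ≤ ‖u‖ ^ 2 - 1 / 2 * ∑' k, w k * ‖mFourierCoeff (EuclideanSpace.complexify ∘ ⇑u) k‖ ^ 2) :
    1 / 2 * (∑ k ∈ S, w k * ‖mFourierCoeff (EuclideanSpace.complexify ∘ ⇑u) k‖ ^ 2
        + (‖u‖ ^ 2 - ∑ k ∈ S, ‖mFourierCoeff (EuclideanSpace.complexify ∘ ⇑u) k‖ ^ 2)) ≤ ‖u‖ ^ 2 - ‖T u‖ ^ 2 := by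
  rw [← tsum_weight_eq_sum_add_rest S u w hw1]
  linarith

end Summit.AnomalousDissipation.AnomalousDissipation.Theorems.SolenoidalFractalHomogenisation.LagrangianStep

end
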